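import Summits.ResolutionOfSingularities.ResolutionOfSingularities.Theorems.PurelyInseparableDim4Target
import HarnessLib
import HarnessLib.Audit.Tags

/-!
# Purely inseparable fourfolds `z^p + F(x₁,…,x₄)` — CENTRE RULES add-on
# [OURS · CANDIDATE FRAME v2 · not Hironaka's statement]

Census cell «res-dim4-pi» (D-0157 DOOR 2), boards/ROUTES.md WORD #17.  The first frame
(`PurelyInseparableDim4Target`: MODE 1h = a Hironaka-permissible coordinate centre of LARGEST
dimension, all ties, all equimultiple points) is REFUTED at `p = 2`: the presented state recurs
literally along chart-origin spines (`Mode1hTwoCycle.not_terminates1h_two`, crit-1 K-A-01; K-S1-1 of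
the census: K = A ∧ B ∧ C).  So the CENTRE RULE is part of the unknown.  This module types

* a `CentreRule` (a choice of coordinate centre per presented state), permissible rules, equivariant
  rules, the step relation `StepRule R`, `TerminatesUnder R`;
* the two sub-rules the census runs next: `1h2` (prefer centres satisfying Hauser–Perlega's
  condition (2) = `Perm2`, then largest) and `m1` (only `Perm2` centres, largest; the point always
  qualifies when the origin is `q`-fold) — typed so that their literal cycles, if the sweep finds them,
  are theorems `¬ Terminates1h2 2 2` / `¬ TerminatesM1 2 2` of the same shape as K-A-01;
* OUR QUESTION (iii) of WORD #17: `TerminatesSomeRule p q` — SOME permissible rule has no infinite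
  branch (player A of the coordinate game has a winning strategy) — and its kill-certificate shape
  `IsTrap` (a set of `q`-fold states from which EVERY permissible centre can be answered by a chart
  point leading back into the set; a nonempty trap refutes `TerminatesSomeRule`).

Nothing here is asserted about resolution of singularities; nothing here proves resolution in
dim ≥ 4 / char p; counted 0.  Sources of the notions: [cite: HauserPerlega2019PRIMS, §2 (permissible
centres, condition (2))] [cite: Hauser2010, §F] [cite: Hironaka1964, Main Theorem I (permissible
centres)]; the game reading: Hironaka's polyhedra game / Spivakovsky's solution are an ANALOGY only
(different game), named in the census boards, not used here.
-/

set_option linter.dupNamespace false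

namespace Summit.ResolutionOfSingularities.ResolutionOfSingularities.Theorems.PIDim4

/-- A **centre rule**: a choice of coordinate centre `S ⊆ {x₁,…,x₄}` for every presented state.
[folklore] -/
abbrev CentreRule (K : Type) [Field K] : Type := State K → Finset (Fin 4)

/-- The rule picks a Hironaka-permissible coordinate centre whenever one exists (equivalently:
whenever the origin is a `q`-fold point, since then the point `univ` is permissible).
[cite: Hironaka1964, Main Theorem I (permissible centres)] -/
def IsPermissibleRule {K : Type} [Field K] (q : ℕ) (R : CentreRule K) : Prop :=
  ∀ s : State K, (∃ S, IsPermissibleCentre q S s.F) → IsPermissibleCentre q (R s) s.F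

/-- `S₄`-equivariance of a rule: renaming the coordinates renames the chosen centre. [folklore] -/
def IsEquivariantRule {K : Type} [Field K] (R : CentreRule K) : Prop :=
  ∀ (e : Equiv.Perm (Fin 4)) (s : State K), R (State.rename e s) = (R s).map e.toEmbedding

/-- One step under the rule `R`: blow up `R s` (required permissible), then pass to any
equimultiple point of a chart with non-zero cleaned transform (`Edge`). [folklore] -/
def StepRule {K : Type} [Field K] [DecidableEq K] (q : ℕ) (R : CentreRule K)
    (s s' : State K) : Prop :=
  IsPermissibleCentre q (R s) s.F ∧ Edge q (R s) s s'

/-- No infinite branch under the rule `R` (over the field `K`). [folklore] -/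
def TerminatesUnder {K : Type} [Field K] [DecidableEq K] (q : ℕ) (R : CentreRule K) : Prop :=
  ¬ ∃ c : ℕ → State K, ∀ k, StepRule q R (c k) (c (k + 1))

/-- A well-founded quantity strictly decreasing along the steps of the rule `R`. [folklore] -/
def SecondaryInvariantUnder {K : Type} [Field K] [DecidableEq K] (q : ℕ) (R : CentreRule K) :
    Prop :=
  ∃ (W : Type) (lt : W → W → Prop), WellFounded lt ∧
    ∃ Φ : State K → W, ∀ s s', StepRule q R s s' → lt (Φ s') (Φ s)

/-- **OUR QUESTION (WORD #17 (iii))**, local form: over every field of characteristic `p`, SOME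
permissible coordinate-centre rule has no infinite branch.  OURS · CANDIDATE · not a printed
statement; refuted at once by a nonempty `IsTrap` set. [folklore] -/
def TerminatesSomeRule (p q : ℕ) : Prop :=
  ∀ (K : Type) [Field K] [CharP K p] [DecidableEq K],
    ∃ R : CentreRule K, IsPermissibleRule q R ∧ TerminatesUnder q R

/-- The equivariant variant (canonicity under renaming of coordinates). [folklore] -/
def TerminatesSomeEquivariantRule (p q : ℕ) : Prop :=
  ∀ (K : Type) [Field K] [CharP K p] [DecidableEq K],
    ∃ R : CentreRule K, IsPermissibleRule q R ∧ IsEquivariantRule R ∧ TerminatesUnder q R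

/-- **OUR QUESTION, global form** (the cell's conjecture-CANDIDATE after K-S1-1; clearly not
Hironaka's theorem or conjecture): for every prime `p`, with `q = p` (`e = 1`), some permissible
coordinate-centre rule terminates on purely inseparable fourfold states. [folklore] -/
@[conjecture] def TerminatesSomeRuleQuestion : Prop :=
  ∀ p : ℕ, p.Prime → TerminatesSomeRule p p

/-- **Kill-certificate shape for `TerminatesSomeRule`**: a TRAP is a set `T` of states, each with a
`q`-fold origin, such that from every `s ∈ T` EVERY permissible coordinate centre admits a chart
point whose (cleaned, non-zero) transform lies again in `T`.  Player B then keeps the walk inside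
`T` for ever, whatever rule A uses. [folklore] -/
def IsTrap {K : Type} [Field K] [DecidableEq K] (q : ℕ) (T : Set (State K)) : Prop :=
  ∀ s ∈ T, (q : ℕ∞) ≤ Literature.AlgebraicGeometry.Resolution.CentreBlowup.ordAlong Finset.univ s.F ∧
    ∀ S, IsPermissibleCentre q S s.F → ∃ s' ∈ T, Edge q S s s'

/-- A nonempty trap defeats every permissible rule (player B stays in the trap). [folklore] -/
theorem not_terminatesUnder_of_trap {K : Type} [Field K] [DecidableEq K] (q : ℕ)
    (T : Set (State K)) (hT : IsTrap q T) (hne : T.Nonempty) (R : CentreRule K)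
    (hR : IsPermissibleRule q R) : ¬ TerminatesUnder q R := by
  intro hterm
  apply hterm
  have key : ∀ s : T, ∃ s' : T, StepRule q R s s' := by
    rintro ⟨s, hs⟩
    obtain ⟨hord, hall⟩ := hT s hs
    have hperm : IsPermissibleCentre q (R s) s.F :=
      hR s ⟨Finset.univ, ⟨Finset.univ_nonempty, hord⟩⟩
    obtain ⟨s', hs', hedge⟩ := hall (R s) hperm
    exact ⟨⟨s', hs'⟩, hperm, hedge⟩
  choose f hf using key
  obtain ⟨s₀, hs₀⟩ := hne
  refine ⟨fun k => ((f^[k] ⟨s₀, hs₀⟩ : T) : State K), fun k => ?_⟩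
  show StepRule q R ((f^[k] ⟨s₀, hs₀⟩ : T) : State K) ((f^[k + 1] ⟨s₀, hs₀⟩ : T) : State K)
  rw [Function.iterate_succ_apply']
  exact hf _

/-- Hence a nonempty trap over one field of characteristic `p` refutes `TerminatesSomeRule p q`:
the census' kill path for OUR QUESTION. [folklore] -/
theorem not_terminatesSomeRule_of_trap (p q : ℕ) (K : Type) [Field K] [CharP K p] [DecidableEq K]
    (T : Set (State K)) (hT : IsTrap q T) (hne : T.Nonempty) : ¬ TerminatesSomeRule p q :=
  fun h => by
    obtain ⟨R, hR, hterm⟩ := h K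
    exact not_terminatesUnder_of_trap q T hT hne R hR hterm

/-- **Sub-rule 1h2** (WORD #12 (c) / #17): a permissible centre; if some permissible centre satisfies
Hauser–Perlega's condition (2) (`Perm2`) then so does `S`; and `S` has least cardinality (largest
dimension) within that preferred class.  All ties allowed.
[cite: HauserPerlega2019PRIMS, §2 (conditions (1), (2))] -/
def IsMode1h2Centre {K : Type} [Field K] (q : ℕ) (S : Finset (Fin 4)) (s : State K) : Prop :=
  IsPermissibleCentre q S s.F ∧
    ((∃ S', IsPermissibleCentre q S' s.F ∧ Perm2 S' s) → Perm2 S s) ∧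
    ∀ S', IsPermissibleCentre q S' s.F →
      ((∃ S'', IsPermissibleCentre q S'' s.F ∧ Perm2 S'' s) → Perm2 S' s) → S.card ≤ S'.card

/-- a 1h2 step. [folklore] -/
def Step1h2 {K : Type} [Field K] [DecidableEq K] (q : ℕ) (s s' : State K) : Prop :=
  ∃ S, IsMode1h2Centre q S s ∧ Edge q S s s'

/-- no infinite 1h2 branch in characteristic `p` (census sub-run S-1a-1h2 decides small cases). [folklore] -/
def Terminates1h2 (p q : ℕ) : Prop :=
  ∀ (K : Type) [Field K] [CharP K p] [DecidableEq K],
    ¬ ∃ c : ℕ → State K, ∀ k, Step1h2 q (c k) (c (k + 1))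

/-- **Sub-rule m1** (WORD #3 / #14 (d)): only centres satisfying (1) ∧ (2) (`Perm2`), of least
cardinality among those; the point qualifies whenever the origin is `q`-fold.  All ties allowed.
[cite: HauserPerlega2019PRIMS, §2 (conditions (1), (2))] -/
def IsModeM1Centre {K : Type} [Field K] (q : ℕ) (S : Finset (Fin 4)) (s : State K) : Prop :=
  IsPermissibleCentre q S s.F ∧ Perm2 S s ∧
    ∀ S', IsPermissibleCentre q S' s.F → Perm2 S' s → S.card ≤ S'.card

/-- an m1 step. [folklore] -/
def StepM1 {K : Type} [Field K] [DecidableEq K] (q : ℕ) (s s' : State K) : Prop :=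
  ∃ S, IsModeM1Centre q S s ∧ Edge q S s s'

/-- no infinite m1 branch in characteristic `p` (census sub-run S-1a-m1; idea-2 P-2-2 B claims a
literal 3-cycle at `p = 2`, one lane). [folklore] -/
def TerminatesM1 (p q : ℕ) : Prop :=
  ∀ (K : Type) [Field K] [CharP K p] [DecidableEq K],
    ¬ ∃ c : ℕ → State K, ∀ k, StepM1 q (c k) (c (k + 1))

/-- The LINE's re-typed downstream crux (S3R of LINE v3): a terminating permissible rule for
`q = p` yields embedded order reduction of the order-`p` locus of `z^p + F` (the marked-ideal
statement `OrderReduction` of the target file).  OURS · the hard half. [folklore] -/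
def SomeRuleImpliesOrderReduction (p : ℕ) : Prop :=
  TerminatesSomeRule p p → OrderReduction p

end Summit.ResolutionOfSingularities.ResolutionOfSingularities.Theorems.PIDim4
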